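import Summits.NavierStokesRegularity.NavierStokesRegularity.Theses.CoreLogGas
import Summits.NavierStokesRegularity.NavierStokesRegularity.Theorems.CoreLogGasBlowupIsLocallyDrivenFarFieldReduction
import Summits.NavierStokesRegularity.NavierStokesRegularity.Theorems.CoreLogGasBlowupIsLocallyDrivenShellEquivalence

/-!
# Crux `CoreLogGas.BlowupIsLocallyDriven` (stmt-NavierStokesRegularity-11291): the far-field reduction for the
# SCALE-FREE (rate-form) locality modulus

`--supports stmt-NavierStokesRegularity-11291` (lead `prover-line-stmt-NavierStokesRegularity-11291-c4-0`, 2026-08-17).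

Context. The crux B as filed asks, for every maximal finite-energy classical solution from Clay data, for ONE `M ≥ 1`
and a time-integrable `g` bounding ABSOLUTELY the symmetric velocity gradient induced at every deep near-maximum
vorticity point `x` (canonical core radius `ρ`) by the vorticity outside `B(x, Mρ)`. Line `registered` reduced B to
shell locality (`Registered.blowupIsLocallyDriven_of_shellLocality`, this crux's FarFieldReduction file) and the converse
holds too (`Registered.blowupIsLocallyDriven_iff_shellLocalityCollapse`, ShellEquivalence file), while
`Negative.BlowupIsLocallyDriven_false_of_RigidFarStrainBlowup` shows the fixed-`M` absolute form fails for every rigidly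
far-strained collapse (tube seen off-axis, antiparallel pair, ring, blob, sheet alike: a fixed positive fraction of
`Ω(t) = sup|ω(t)|` against `∫Ω = ∞`). The refuters' repair (R1/R2, `B_quadratic`) and the leads' recommendation is the
SCALE-FREE modulus with a rate: `∃ C ≥ 0, t₀ < T, g ∈ L¹(t₀,T)` such that for ALL `M ≥ 1` and all admissible
`(t, x, ρ)`, `|⟪defect_{Mρ} e, e⟫| ≤ C·M⁻²·Ω(t) + g(t)` — sheets (`∼ Ω/M`) fail it as the route intends, rigid tubes /
pairs (`∼ Ω/M⁴`) and rings / blobs (`∼ Ω/M²`) pass, and the `+ g` absorbs the energy-class far field.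

This file proves that the landed far-field machinery serves that rate form UNCHANGED:

* `bRate_of_shellRate` — **the rate-form crux follows from rate-form shell locality.** If every maximal solution admits
  `C ≥ 0`, `t₀ < T`, `R > 0`, `g₁ ∈ L¹(t₀,T)` with, for all `M ≥ 1` and all admissible `(t,x,ρ)` with `Mρ ≤ R`,
  `|⟪(∇BS[1_{B(x,R)}ω] − ∇BS[1_{B(x,Mρ)}ω])(x) e, e⟫| ≤ C/M²·Ω(t) + g₁(t)` (the vorticity in the SHELL `B(x,R) ∖ B(x,Mρ)`
  strains the peak at most at the rate `C/M²` in core units, up to an integrable error), then the rate-form statement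
  holds with the same `C` and `g := |g₁| + C_far (√((R/3)⁻⁵) ‖u 0‖₂ + √((R/3)⁻³) ‖∇u(t)‖₂)`: `Registered.farFieldStrain` at
  radius `R` (resp. `Mρ` when `Mρ > R`), the Leray–Hopf energy bound and `Registered.stub_enstrophyControl`, exactly as
  in the absolute form.
* `bRateStretch_of_bRate` — the all-directions modulus implies the STRETCHING-DIRECTION modulus
  (`e = ω(t,x)/|ω(t,x)|`, written division-free), the weaker variant singled out by lead c3 (Constantin's identity: far
  vorticity parallel / antiparallel to `ξ(x)` does not stretch).

Both statements are written over verbatim sub-terms of the route decl (the Biot–Savart velocity written out over the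
in-tree `cross` / `curl`, `Ω(t)` as the `Real.iSup` of `‖curl (u t) ·‖`), so that a re-typed crux of this shape is served
by name. Nothing here changes the status of B as filed.

References: T. Tao, arXiv:1108.1165 §10 (local Biot–Savart law, through `farFieldStrain`); P. Constantin, SIAM Rev. 36
(1994) 73–98 (stretching identity); A. J. Majda, A. L. Bertozzi, *Vorticity and Incompressible Flow* (CUP 2002) §2.4.
-/

noncomputable section

open Set MeasureTheory Filter Topology Metric
open scoped ContDiff

-- justification: the namespace is fixed by the crux protocol (sibling files of this crux use `…Theorems.BlowupIsLocallyDriven.*`).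
set_option linter.dupNamespace false

namespace Summit.NavierStokesRegularity.NavierStokesRegularity.Theorems.BlowupIsLocallyDriven.Rate

open Literature.Analysis.FluidPDE
open Summit.NavierStokesRegularity.NavierStokesRegularity.Theorems.BlowupIsLocallyDriven.Registered

/-! ### Elementary lemmas -/

/-- The vorticity maximum `Ω(t) = ⨆ ‖curl w ·‖` (a `Real.iSup` of nonnegative reals) is nonnegative — also in the junk
case of an unbounded family, where it is `0`. [folklore] -/
theorem iSup_norm_curl_nonneg (w : EuclideanSpace ℝ (Fin 3) → EuclideanSpace ℝ (Fin 3)) :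
    0 ≤ ⨆ z, ‖Literature.Analysis.FluidPDE.curl w z‖ :=
  Real.iSup_nonneg fun _ => norm_nonneg _

/-- Quadratic-form scaling: `⟪D (c • e), c • e⟫ = c² ⟪D e, e⟫`. [folklore] -/
theorem inner_apply_smul_self (D : EuclideanSpace ℝ (Fin 3) →L[ℝ] EuclideanSpace ℝ (Fin 3))
    (c : ℝ) (e : EuclideanSpace ℝ (Fin 3)) :
    inner ℝ (D (c • e)) (c • e) = c ^ 2 * inner ℝ (D e) e := by
  rw [map_smul, inner_smul_left, inner_smul_right]
  simp only [conj_trivial]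
  ring

/-! ### The rate-form crux follows from rate-form shell locality -/

/-- **Rate-form far-field reduction.** If every maximal finite-energy classical solution from Clay data admits `C ≥ 0`,
`t₀ < T`, `R > 0` and an integrable `g₁` such that for ALL `M ≥ 1`, at every deep near-maximum vorticity point `x` with
canonical core radius `ρ`, `Mρ ≤ R`, and every unit `e`, the symmetric gradient induced at `x` by the vorticity in the
shell `B(x,R) ∖ B(x,Mρ)` is at most `C / M² · Ω(t) + g₁(t)` (`Ω(t) = ⨆ ‖curl (u t) ·‖`), then the scale-free locality
modulus holds for the full exterior of `B(x,Mρ)` with the same `C`: `g := |g₁| + C_far (√((R/3)⁻⁵) ‖u 0‖₂ +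
√((R/3)⁻³) ‖∇u(t)‖₂)`, integrable on `[t₀,T)` by the energy bound and `stub_enstrophyControl`; at radius `Mρ ≤ R` split
the exterior at `R` (`farFieldStrain` + hypothesis), at `Mρ > R` apply `farFieldStrain` directly at radius `Mρ`
(antitone in the radius) and use `0 ≤ C/M²·Ω(t)`. [folklore] -/
theorem bRate_of_shellRate :
    (∀ (ν T : ℝ), 0 < ν → 0 < T →
    ∀ (u : ℝ → EuclideanSpace ℝ (Fin 3) → EuclideanSpace ℝ (Fin 3)) (p : ℝ → EuclideanSpace ℝ (Fin 3) → ℝ),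
      Literature.Analysis.FluidPDE.IsMaximalSmoothSolution ν 0 u p T →
      Literature.Analysis.FluidPDE.IsLerayHopfOn T ν 0 (u 0) u →
      Literature.Analysis.FluidPDE.HasRapidSpatialDecay (u 0) →
      ∃ (C t₀ R : ℝ) (g₁ : ℝ → ℝ), 0 ≤ C ∧ 0 ≤ t₀ ∧ t₀ < T ∧ 0 < R ∧
        MeasureTheory.IntegrableOn g₁ (Set.Ico t₀ T) ∧
        ∀ (M : ℝ), 1 ≤ M → ∀ t ∈ Set.Ico t₀ T, ∀ (x : EuclideanSpace ℝ (Fin 3)) (ρ : ℝ), 0 < ρ → M * ρ ≤ R →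
          (⨆ z, ‖Literature.Analysis.FluidPDE.curl (u t) z‖) ≤ 2 * ‖Literature.Analysis.FluidPDE.curl (u t) x‖ →
          Metric.ball x ρ ⊆ {y | (⨆ z, ‖Literature.Analysis.FluidPDE.curl (u t) z‖) ≤ 4 * ‖Literature.Analysis.FluidPDE.curl (u t) y‖} →
          (∀ (x' : EuclideanSpace ℝ (Fin 3)) (ρ' : ℝ),
            (⨆ z, ‖Literature.Analysis.FluidPDE.curl (u t) z‖) ≤ 2 * ‖Literature.Analysis.FluidPDE.curl (u t) x'‖ →
            Metric.ball x' ρ' ⊆ {y | (⨆ z, ‖Literature.Analysis.FluidPDE.curl (u t) z‖) ≤ 4 * ‖Literature.Analysis.FluidPDE.curl (u t) y‖} →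
            ρ' ≤ 2 * ρ) →
          ∀ e : EuclideanSpace ℝ (Fin 3), ‖e‖ = 1 →
            |inner ℝ ((fderiv ℝ (fun z : EuclideanSpace ℝ (Fin 3) => ∫ y, (4 * Real.pi * ‖z - y‖ ^ 3)⁻¹ • Literature.Analysis.FluidPDE.cross ((Metric.ball x R).indicator (Literature.Analysis.FluidPDE.curl (u t)) y) (z - y)) x
              - fderiv ℝ (fun z : EuclideanSpace ℝ (Fin 3) => ∫ y, (4 * Real.pi * ‖z - y‖ ^ 3)⁻¹ • Literature.Analysis.FluidPDE.cross ((Metric.ball x (M * ρ)).indicator (Literature.Analysis.FluidPDE.curl (u t)) y) (z - y)) x) e) e|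
              ≤ C / M ^ 2 * (⨆ z, ‖Literature.Analysis.FluidPDE.curl (u t) z‖) + g₁ t) →
    ∀ (ν T : ℝ), 0 < ν → 0 < T →
    ∀ (u : ℝ → EuclideanSpace ℝ (Fin 3) → EuclideanSpace ℝ (Fin 3)) (p : ℝ → EuclideanSpace ℝ (Fin 3) → ℝ),
      Literature.Analysis.FluidPDE.IsMaximalSmoothSolution ν 0 u p T →
      Literature.Analysis.FluidPDE.IsLerayHopfOn T ν 0 (u 0) u →
      Literature.Analysis.FluidPDE.HasRapidSpatialDecay (u 0) →
      ∃ (C t₀ : ℝ) (g : ℝ → ℝ), 0 ≤ C ∧ 0 ≤ t₀ ∧ t₀ < T ∧ MeasureTheory.IntegrableOn g (Set.Ico t₀ T) ∧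
        ∀ (M : ℝ), 1 ≤ M → ∀ t ∈ Set.Ico t₀ T, ∀ (x : EuclideanSpace ℝ (Fin 3)) (ρ : ℝ), 0 < ρ →
          (⨆ z, ‖Literature.Analysis.FluidPDE.curl (u t) z‖) ≤ 2 * ‖Literature.Analysis.FluidPDE.curl (u t) x‖ →
          Metric.ball x ρ ⊆ {y | (⨆ z, ‖Literature.Analysis.FluidPDE.curl (u t) z‖) ≤ 4 * ‖Literature.Analysis.FluidPDE.curl (u t) y‖} →
          (∀ (x' : EuclideanSpace ℝ (Fin 3)) (ρ' : ℝ),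
            (⨆ z, ‖Literature.Analysis.FluidPDE.curl (u t) z‖) ≤ 2 * ‖Literature.Analysis.FluidPDE.curl (u t) x'‖ →
            Metric.ball x' ρ' ⊆ {y | (⨆ z, ‖Literature.Analysis.FluidPDE.curl (u t) z‖) ≤ 4 * ‖Literature.Analysis.FluidPDE.curl (u t) y‖} →
            ρ' ≤ 2 * ρ) →
          ∀ e : EuclideanSpace ℝ (Fin 3), ‖e‖ = 1 →
            |inner ℝ ((fderiv ℝ (u t) x - fderiv ℝ (fun z : EuclideanSpace ℝ (Fin 3) => ∫ y, (4 * Real.pi * ‖z - y‖ ^ 3)⁻¹ • Literature.Analysis.FluidPDE.cross ((Metric.ball x (M * ρ)).indicator (Literature.Analysis.FluidPDE.curl (u t)) y) (z - y)) x) e) e|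
              ≤ C / M ^ 2 * (⨆ z, ‖Literature.Analysis.FluidPDE.curl (u t) z‖) + g t := by
  intro hI ν T hν hT u p hmax hlh hdec
  obtain ⟨C, hC0, hC⟩ := farFieldStrain
  have hcl : Literature.Analysis.FluidPDE.IsClassicalNSSolutionOn (Set.Ico 0 T) ν 0 u p := hmax.1
  obtain ⟨hint, hsq⟩ := stub_enstrophyControl ν T hν hT u p hcl hlh hdec
  obtain ⟨C₁, t₀, R, g₁, hC₁, ht₀, ht₀T, hR, hg₁, hH⟩ := hI ν T hν hT u p hmax hlh hdec
  -- the far-field majorant at radius `R` (opaque name)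
  obtain ⟨Φ, hΦ⟩ : ∃ Φ : ℝ → ℝ, Φ = fun t => C * (Real.sqrt ((R / 3)⁻¹ ^ 5) * Real.sqrt (∫ y, ‖u 0 y‖ ^ 2) +
      Real.sqrt ((R / 3)⁻¹ ^ 3) * Real.sqrt (∫ y, ‖fderiv ℝ (u t) y‖ ^ 2)) := ⟨_, rfl⟩
  refine ⟨C₁, t₀, fun t => |g₁ t| + Φ t, hC₁, ht₀, ht₀T, ?_, ?_⟩
  · -- integrability of g on [t₀, T)
    have hsub : Set.Ico t₀ T ⊆ Set.Ico 0 T := Set.Ico_subset_Ico_left ht₀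
    have hN : MeasureTheory.IntegrableOn (fun t => Real.sqrt (∫ y, ‖fderiv ℝ (u t) y‖ ^ 2)) (Set.Ico t₀ T)
        MeasureTheory.volume := hsq.mono_set hsub
    have hΦi : MeasureTheory.IntegrableOn Φ (Set.Ico t₀ T) MeasureTheory.volume := by
      have h1 : MeasureTheory.IntegrableOn (fun _ : ℝ => Real.sqrt ((R / 3)⁻¹ ^ 5) * Real.sqrt (∫ y, ‖u 0 y‖ ^ 2))
          (Set.Ico t₀ T) MeasureTheory.volume := integrableOn_const (by simp)
      rw [hΦ]
      exact ((h1.add (hN.integrable.const_mul _)).integrable.const_mul C)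
    exact hg₁.integrable.abs.add hΦi
  · intro M hM t ht x ρ hρ hpeak hball hmaxrad e he
    -- classical facts at the time slice t
    have ht' : t ∈ Set.Ico 0 T := ⟨ht₀.trans ht.1, ht.2⟩
    have hCi : ContDiff ℝ ∞ (u t) := hcl.contDiff_velocity ht'
    have hdiv : Literature.Analysis.FluidPDE.VectorCalculus.IsDivFree (u t) := hcl.divFree t ht'
    have hL2 : MeasureTheory.MemLp (u t) 2 MeasureTheory.volume := hlh.memLp t ⟨ht'.1, ht'.2.le⟩
    have hgrad : MeasureTheory.Integrable (fun y => ‖fderiv ℝ (u t) y‖ ^ 2) MeasureTheory.volume := hint t ht'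
    -- energy: `‖u t‖₂ ≤ ‖u 0‖₂`
    have hen : Real.sqrt (∫ y, ‖u t y‖ ^ 2) ≤ Real.sqrt (∫ y, ‖u 0 y‖ ^ 2) :=
      Real.sqrt_le_sqrt (farField_integral_norm_sq_le_datum hlh hν.le ⟨ht'.1, ht'.2.le⟩)
    -- the far-field bound at any radius `S ≥ R` is at most `Φ t`
    have hfar : ∀ S : ℝ, R ≤ S →
        |inner ℝ ((fderiv ℝ (u t) x - fderiv ℝ (fun z : EuclideanSpace ℝ (Fin 3) => ∫ y, (4 * Real.pi * ‖z - y‖ ^ 3)⁻¹ • Literature.Analysis.FluidPDE.cross ((Metric.ball x S).indicator (Literature.Analysis.FluidPDE.curl (u t)) y) (z - y)) x) e) e|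
          ≤ Φ t := by
      intro S hRS
      have hS : 0 < S := hR.trans_le hRS
      refine (hC (u t) hCi hdiv hL2 hgrad S hS x e he).trans ?_
      have hmono : ∀ k : ℕ, Real.sqrt ((S / 3)⁻¹ ^ k) ≤ Real.sqrt ((R / 3)⁻¹ ^ k) := by
        intro k
        apply Real.sqrt_le_sqrt
        apply pow_le_pow_left₀ (by positivity)
        exact inv_anti₀ (by positivity) (by linarith)
      rw [hΦ]
      have hb0 : 0 ≤ Real.sqrt (∫ y, ‖fderiv ℝ (u t) y‖ ^ 2) := Real.sqrt_nonneg _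
      have ha0 : 0 ≤ Real.sqrt (∫ y, ‖u 0 y‖ ^ 2) := Real.sqrt_nonneg _
      have hsS : 0 ≤ Real.sqrt ((S / 3)⁻¹ ^ 5) := Real.sqrt_nonneg _
      refine mul_le_mul_of_nonneg_left (add_le_add ?_ ?_) hC0
      · exact mul_le_mul (hmono 5) hen (Real.sqrt_nonneg _) (Real.sqrt_nonneg _)
      · exact mul_le_mul_of_nonneg_right (hmono 3) hb0
    -- the rate term is nonnegative (also in the `Real.iSup` junk case)
    have hΩ : 0 ≤ C₁ / M ^ 2 * (⨆ z, ‖Literature.Analysis.FluidPDE.curl (u t) z‖) :=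
      mul_nonneg (div_nonneg hC₁ (sq_nonneg M)) (iSup_norm_curl_nonneg (u t))
    have hg₁abs : g₁ t ≤ |g₁ t| := le_abs_self _
    show _ ≤ C₁ / M ^ 2 * (⨆ z, ‖Literature.Analysis.FluidPDE.curl (u t) z‖) + (|g₁ t| + Φ t)
    by_cases hcase : M * ρ ≤ R
    · -- split the exterior at radius R: far field + intermediate shell
      have h1 := hfar R le_rfl
      have h2 := hH M hM t ht x ρ hρ hcase hpeak hball hmaxrad e he
      have h12 := add_le_add h1 h2
      refine ((farField_abs_inner_sub_le_split _ _ _ e).trans h12).trans ?_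
      linarith
    · -- the M-ball already contains B(x,R): the far-field bound applies directly at radius M ρ
      refine (hfar (M * ρ) (lt_of_not_ge hcase).le).trans ?_
      linarith [abs_nonneg (g₁ t)]

/-! ### The stretching-direction variant is weaker -/

/-- **All directions ⇒ stretching direction.** The scale-free modulus for all unit `e` implies the division-free
stretching-direction form `|⟪defect_{Mρ} ω(t,x), ω(t,x)⟫| ≤ (C/M²·Ω(t) + g(t))·‖ω(t,x)‖²` (take `e = ω(t,x)/‖ω(t,x)‖`
when `ω(t,x) ≠ 0`; both sides vanish otherwise). [folklore] -/
theorem bRateStretch_of_bRate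
    (hB : ∀ (ν T : ℝ), 0 < ν → 0 < T →
    ∀ (u : ℝ → EuclideanSpace ℝ (Fin 3) → EuclideanSpace ℝ (Fin 3)) (p : ℝ → EuclideanSpace ℝ (Fin 3) → ℝ),
      Literature.Analysis.FluidPDE.IsMaximalSmoothSolution ν 0 u p T →
      Literature.Analysis.FluidPDE.IsLerayHopfOn T ν 0 (u 0) u →
      Literature.Analysis.FluidPDE.HasRapidSpatialDecay (u 0) →
      ∃ (C t₀ : ℝ) (g : ℝ → ℝ), 0 ≤ C ∧ 0 ≤ t₀ ∧ t₀ < T ∧ MeasureTheory.IntegrableOn g (Set.Ico t₀ T) ∧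
        ∀ (M : ℝ), 1 ≤ M → ∀ t ∈ Set.Ico t₀ T, ∀ (x : EuclideanSpace ℝ (Fin 3)) (ρ : ℝ), 0 < ρ →
          (⨆ z, ‖Literature.Analysis.FluidPDE.curl (u t) z‖) ≤ 2 * ‖Literature.Analysis.FluidPDE.curl (u t) x‖ →
          Metric.ball x ρ ⊆ {y | (⨆ z, ‖Literature.Analysis.FluidPDE.curl (u t) z‖) ≤ 4 * ‖Literature.Analysis.FluidPDE.curl (u t) y‖} →
          (∀ (x' : EuclideanSpace ℝ (Fin 3)) (ρ' : ℝ),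
            (⨆ z, ‖Literature.Analysis.FluidPDE.curl (u t) z‖) ≤ 2 * ‖Literature.Analysis.FluidPDE.curl (u t) x'‖ →
            Metric.ball x' ρ' ⊆ {y | (⨆ z, ‖Literature.Analysis.FluidPDE.curl (u t) z‖) ≤ 4 * ‖Literature.Analysis.FluidPDE.curl (u t) y‖} →
            ρ' ≤ 2 * ρ) →
          ∀ e : EuclideanSpace ℝ (Fin 3), ‖e‖ = 1 →
            |inner ℝ ((fderiv ℝ (u t) x - fderiv ℝ (fun z : EuclideanSpace ℝ (Fin 3) => ∫ y, (4 * Real.pi * ‖z - y‖ ^ 3)⁻¹ • Literature.Analysis.FluidPDE.cross ((Metric.ball x (M * ρ)).indicator (Literature.Analysis.FluidPDE.curl (u t)) y) (z - y)) x) e) e|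
              ≤ C / M ^ 2 * (⨆ z, ‖Literature.Analysis.FluidPDE.curl (u t) z‖) + g t) :
    ∀ (ν T : ℝ), 0 < ν → 0 < T →
    ∀ (u : ℝ → EuclideanSpace ℝ (Fin 3) → EuclideanSpace ℝ (Fin 3)) (p : ℝ → EuclideanSpace ℝ (Fin 3) → ℝ),
      Literature.Analysis.FluidPDE.IsMaximalSmoothSolution ν 0 u p T →
      Literature.Analysis.FluidPDE.IsLerayHopfOn T ν 0 (u 0) u →
      Literature.Analysis.FluidPDE.HasRapidSpatialDecay (u 0) →
      ∃ (C t₀ : ℝ) (g : ℝ → ℝ), 0 ≤ C ∧ 0 ≤ t₀ ∧ t₀ < T ∧ MeasureTheory.IntegrableOn g (Set.Ico t₀ T) ∧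
        ∀ (M : ℝ), 1 ≤ M → ∀ t ∈ Set.Ico t₀ T, ∀ (x : EuclideanSpace ℝ (Fin 3)) (ρ : ℝ), 0 < ρ →
          (⨆ z, ‖Literature.Analysis.FluidPDE.curl (u t) z‖) ≤ 2 * ‖Literature.Analysis.FluidPDE.curl (u t) x‖ →
          Metric.ball x ρ ⊆ {y | (⨆ z, ‖Literature.Analysis.FluidPDE.curl (u t) z‖) ≤ 4 * ‖Literature.Analysis.FluidPDE.curl (u t) y‖} →
          (∀ (x' : EuclideanSpace ℝ (Fin 3)) (ρ' : ℝ),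
            (⨆ z, ‖Literature.Analysis.FluidPDE.curl (u t) z‖) ≤ 2 * ‖Literature.Analysis.FluidPDE.curl (u t) x'‖ →
            Metric.ball x' ρ' ⊆ {y | (⨆ z, ‖Literature.Analysis.FluidPDE.curl (u t) z‖) ≤ 4 * ‖Literature.Analysis.FluidPDE.curl (u t) y‖} →
            ρ' ≤ 2 * ρ) →
          |inner ℝ ((fderiv ℝ (u t) x - fderiv ℝ (fun z : EuclideanSpace ℝ (Fin 3) => ∫ y, (4 * Real.pi * ‖z - y‖ ^ 3)⁻¹ • Literature.Analysis.FluidPDE.cross ((Metric.ball x (M * ρ)).indicator (Literature.Analysis.FluidPDE.curl (u t)) y) (z - y)) x)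
              (Literature.Analysis.FluidPDE.curl (u t) x)) (Literature.Analysis.FluidPDE.curl (u t) x)|
            ≤ (C / M ^ 2 * (⨆ z, ‖Literature.Analysis.FluidPDE.curl (u t) z‖) + g t) *
                ‖Literature.Analysis.FluidPDE.curl (u t) x‖ ^ 2 := by
  intro ν T hν hT u p hmax hlh hdec
  obtain ⟨C, t₀, g, hC, ht₀, ht₀T, hg, hH⟩ := hB ν T hν hT u p hmax hlh hdec
  refine ⟨C, t₀, g, hC, ht₀, ht₀T, hg, fun M hM t ht x ρ hρ hpeak hball hmaxrad => ?_⟩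
  -- name the defect operator and the vorticity vector at `x` (opaque)
  obtain ⟨D, hD⟩ : ∃ D : EuclideanSpace ℝ (Fin 3) →L[ℝ] EuclideanSpace ℝ (Fin 3),
      D = fderiv ℝ (u t) x - fderiv ℝ (fun z : EuclideanSpace ℝ (Fin 3) => ∫ y, (4 * Real.pi * ‖z - y‖ ^ 3)⁻¹ • Literature.Analysis.FluidPDE.cross ((Metric.ball x (M * ρ)).indicator (Literature.Analysis.FluidPDE.curl (u t)) y) (z - y)) x := ⟨_, rfl⟩
  obtain ⟨w, hw⟩ : ∃ w : EuclideanSpace ℝ (Fin 3), w = Literature.Analysis.FluidPDE.curl (u t) x := ⟨_, rfl⟩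
  rw [← hD, ← hw]
  by_cases hw0 : w = 0
  · simp [hw0]
  · have hnw : 0 < ‖w‖ := norm_pos_iff.2 hw0
    obtain ⟨e, he⟩ : ∃ e : EuclideanSpace ℝ (Fin 3), e = ‖w‖⁻¹ • w := ⟨_, rfl⟩
    have hen : ‖e‖ = 1 := by
      rw [he, norm_smul, norm_inv, norm_norm, inv_mul_cancel₀ hnw.ne']
    have hwe : w = ‖w‖ • e := by
      rw [he, smul_smul, mul_inv_cancel₀ hnw.ne', one_smul]
    have hb := hH M hM t ht x ρ hρ hpeak hball hmaxrad e hen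
    rw [← hD] at hb
    calc |inner ℝ (D w) w|
        = |inner ℝ (D (‖w‖ • e)) (‖w‖ • e)| := by rw [← hwe]
      _ = ‖w‖ ^ 2 * |inner ℝ (D e) e| := by
          rw [inner_apply_smul_self, abs_mul, abs_of_nonneg (sq_nonneg _)]
      _ ≤ ‖w‖ ^ 2 * (C / M ^ 2 * (⨆ z, ‖Literature.Analysis.FluidPDE.curl (u t) z‖) + g t) :=
          mul_le_mul_of_nonneg_left hb (sq_nonneg _)
      _ = (C / M ^ 2 * (⨆ z, ‖Literature.Analysis.FluidPDE.curl (u t) z‖) + g t) * ‖w‖ ^ 2 := mul_comm _ _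


/-! ### The converse: rate-form shell locality from the rate-form modulus (lead c4, appended) -/

/-- **The rate-form modulus implies rate-form shell locality** (converse of `bRate_of_shellRate`): with `R = 1`, the same
`C, t₀`, and `g₁ := |g| + C_far (√((1/3)⁻⁵) ‖u 0‖₂ + √((1/3)⁻³) ‖∇u(t)‖₂)`, the shell gradient at an admissible
triple is the far field at radius `1` (`farFieldStrain`) plus the full exterior defect at radius `Mρ`. [folklore] -/
theorem shellRate_of_bRate :
    (∀ (ν T : ℝ), 0 < ν → 0 < T →
    ∀ (u : ℝ → EuclideanSpace ℝ (Fin 3) → EuclideanSpace ℝ (Fin 3)) (p : ℝ → EuclideanSpace ℝ (Fin 3) → ℝ),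
      Literature.Analysis.FluidPDE.IsMaximalSmoothSolution ν 0 u p T →
      Literature.Analysis.FluidPDE.IsLerayHopfOn T ν 0 (u 0) u →
      Literature.Analysis.FluidPDE.HasRapidSpatialDecay (u 0) →
      ∃ (C t₀ : ℝ) (g : ℝ → ℝ), 0 ≤ C ∧ 0 ≤ t₀ ∧ t₀ < T ∧ MeasureTheory.IntegrableOn g (Set.Ico t₀ T) ∧
        ∀ (M : ℝ), 1 ≤ M → ∀ t ∈ Set.Ico t₀ T, ∀ (x : EuclideanSpace ℝ (Fin 3)) (ρ : ℝ), 0 < ρ →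
          (⨆ z, ‖Literature.Analysis.FluidPDE.curl (u t) z‖) ≤ 2 * ‖Literature.Analysis.FluidPDE.curl (u t) x‖ →
          Metric.ball x ρ ⊆ {y | (⨆ z, ‖Literature.Analysis.FluidPDE.curl (u t) z‖) ≤ 4 * ‖Literature.Analysis.FluidPDE.curl (u t) y‖} →
          (∀ (x' : EuclideanSpace ℝ (Fin 3)) (ρ' : ℝ),
            (⨆ z, ‖Literature.Analysis.FluidPDE.curl (u t) z‖) ≤ 2 * ‖Literature.Analysis.FluidPDE.curl (u t) x'‖ →
            Metric.ball x' ρ' ⊆ {y | (⨆ z, ‖Literature.Analysis.FluidPDE.curl (u t) z‖) ≤ 4 * ‖Literature.Analysis.FluidPDE.curl (u t) y‖} →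
            ρ' ≤ 2 * ρ) →
          ∀ e : EuclideanSpace ℝ (Fin 3), ‖e‖ = 1 →
            |inner ℝ ((fderiv ℝ (u t) x - fderiv ℝ (fun z : EuclideanSpace ℝ (Fin 3) => ∫ y, (4 * Real.pi * ‖z - y‖ ^ 3)⁻¹ • Literature.Analysis.FluidPDE.cross ((Metric.ball x (M * ρ)).indicator (Literature.Analysis.FluidPDE.curl (u t)) y) (z - y)) x) e) e|
              ≤ C / M ^ 2 * (⨆ z, ‖Literature.Analysis.FluidPDE.curl (u t) z‖) + g t) →
    (∀ (ν T : ℝ), 0 < ν → 0 < T →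
    ∀ (u : ℝ → EuclideanSpace ℝ (Fin 3) → EuclideanSpace ℝ (Fin 3)) (p : ℝ → EuclideanSpace ℝ (Fin 3) → ℝ),
      Literature.Analysis.FluidPDE.IsMaximalSmoothSolution ν 0 u p T →
      Literature.Analysis.FluidPDE.IsLerayHopfOn T ν 0 (u 0) u →
      Literature.Analysis.FluidPDE.HasRapidSpatialDecay (u 0) →
      ∃ (C t₀ R : ℝ) (g₁ : ℝ → ℝ), 0 ≤ C ∧ 0 ≤ t₀ ∧ t₀ < T ∧ 0 < R ∧
        MeasureTheory.IntegrableOn g₁ (Set.Ico t₀ T) ∧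
        ∀ (M : ℝ), 1 ≤ M → ∀ t ∈ Set.Ico t₀ T, ∀ (x : EuclideanSpace ℝ (Fin 3)) (ρ : ℝ), 0 < ρ → M * ρ ≤ R →
          (⨆ z, ‖Literature.Analysis.FluidPDE.curl (u t) z‖) ≤ 2 * ‖Literature.Analysis.FluidPDE.curl (u t) x‖ →
          Metric.ball x ρ ⊆ {y | (⨆ z, ‖Literature.Analysis.FluidPDE.curl (u t) z‖) ≤ 4 * ‖Literature.Analysis.FluidPDE.curl (u t) y‖} →
          (∀ (x' : EuclideanSpace ℝ (Fin 3)) (ρ' : ℝ),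
            (⨆ z, ‖Literature.Analysis.FluidPDE.curl (u t) z‖) ≤ 2 * ‖Literature.Analysis.FluidPDE.curl (u t) x'‖ →
            Metric.ball x' ρ' ⊆ {y | (⨆ z, ‖Literature.Analysis.FluidPDE.curl (u t) z‖) ≤ 4 * ‖Literature.Analysis.FluidPDE.curl (u t) y‖} →
            ρ' ≤ 2 * ρ) →
          ∀ e : EuclideanSpace ℝ (Fin 3), ‖e‖ = 1 →
            |inner ℝ ((fderiv ℝ (fun z : EuclideanSpace ℝ (Fin 3) => ∫ y, (4 * Real.pi * ‖z - y‖ ^ 3)⁻¹ • Literature.Analysis.FluidPDE.cross ((Metric.ball x R).indicator (Literature.Analysis.FluidPDE.curl (u t)) y) (z - y)) x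
              - fderiv ℝ (fun z : EuclideanSpace ℝ (Fin 3) => ∫ y, (4 * Real.pi * ‖z - y‖ ^ 3)⁻¹ • Literature.Analysis.FluidPDE.cross ((Metric.ball x (M * ρ)).indicator (Literature.Analysis.FluidPDE.curl (u t)) y) (z - y)) x) e) e|
              ≤ C / M ^ 2 * (⨆ z, ‖Literature.Analysis.FluidPDE.curl (u t) z‖) + g₁ t) := by
  intro hB ν T hν hT u p hmax hlh hdec
  obtain ⟨C, hC0, hC⟩ := farFieldStrain
  have hcl : Literature.Analysis.FluidPDE.IsClassicalNSSolutionOn (Set.Ico 0 T) ν 0 u p := hmax.1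
  obtain ⟨hint, hsq⟩ := stub_enstrophyControl ν T hν hT u p hcl hlh hdec
  obtain ⟨C₁, t₀, g, hC₁, ht₀, ht₀T, hg, hH⟩ := hB ν T hν hT u p hmax hlh hdec
  -- the far-field majorant at radius `1` (opaque name)
  obtain ⟨Φ, hΦ⟩ : ∃ Φ : ℝ → ℝ, Φ = fun t => C * (Real.sqrt (((1 : ℝ) / 3)⁻¹ ^ 5) * Real.sqrt (∫ y, ‖u 0 y‖ ^ 2) +
      Real.sqrt (((1 : ℝ) / 3)⁻¹ ^ 3) * Real.sqrt (∫ y, ‖fderiv ℝ (u t) y‖ ^ 2)) := ⟨_, rfl⟩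
  refine ⟨C₁, t₀, 1, fun t => |g t| + Φ t, hC₁, ht₀, ht₀T, one_pos, ?_, ?_⟩
  · -- integrability of `g₁` on `[t₀, T)`
    have hsub : Set.Ico t₀ T ⊆ Set.Ico 0 T := Set.Ico_subset_Ico_left ht₀
    have hN : MeasureTheory.IntegrableOn (fun t => Real.sqrt (∫ y, ‖fderiv ℝ (u t) y‖ ^ 2)) (Set.Ico t₀ T)
        MeasureTheory.volume := hsq.mono_set hsub
    have hΦi : MeasureTheory.IntegrableOn Φ (Set.Ico t₀ T) MeasureTheory.volume := by
      have h1 : MeasureTheory.IntegrableOn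
          (fun _ : ℝ => Real.sqrt (((1 : ℝ) / 3)⁻¹ ^ 5) * Real.sqrt (∫ y, ‖u 0 y‖ ^ 2))
          (Set.Ico t₀ T) MeasureTheory.volume := integrableOn_const (by simp)
      rw [hΦ]
      exact ((h1.add (hN.integrable.const_mul _)).integrable.const_mul C)
    exact hg.integrable.abs.add hΦi
  · intro M hM t ht x ρ hρ _hMρ hpeak hball hmaxrad e he
    -- classical facts at the time slice `t`
    have ht' : t ∈ Set.Ico 0 T := ⟨ht₀.trans ht.1, ht.2⟩
    have hCi : ContDiff ℝ ∞ (u t) := hcl.contDiff_velocity ht'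
    have hdiv : Literature.Analysis.FluidPDE.VectorCalculus.IsDivFree (u t) := hcl.divFree t ht'
    have hL2 : MeasureTheory.MemLp (u t) 2 MeasureTheory.volume := hlh.memLp t ⟨ht'.1, ht'.2.le⟩
    have hgrad : MeasureTheory.Integrable (fun y => ‖fderiv ℝ (u t) y‖ ^ 2) MeasureTheory.volume := hint t ht'
    -- energy: `‖u t‖₂ ≤ ‖u 0‖₂`
    have hen : Real.sqrt (∫ y, ‖u t y‖ ^ 2) ≤ Real.sqrt (∫ y, ‖u 0 y‖ ^ 2) :=
      Real.sqrt_le_sqrt (farField_integral_norm_sq_le_datum hlh hν.le ⟨ht'.1, ht'.2.le⟩)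
    -- the far field at radius `1` is at most `Φ t`
    have hfar :
        |inner ℝ ((fderiv ℝ (u t) x - fderiv ℝ (fun z : EuclideanSpace ℝ (Fin 3) => ∫ y, (4 * Real.pi * ‖z - y‖ ^ 3)⁻¹ • Literature.Analysis.FluidPDE.cross ((Metric.ball x 1).indicator (Literature.Analysis.FluidPDE.curl (u t)) y) (z - y)) x) e) e|
          ≤ Φ t := by
      refine (hC (u t) hCi hdiv hL2 hgrad 1 one_pos x e he).trans ?_
      rw [hΦ]
      have hb0 : 0 ≤ Real.sqrt (∫ y, ‖fderiv ℝ (u t) y‖ ^ 2) := Real.sqrt_nonneg _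
      have hs5 : 0 ≤ Real.sqrt (((1 : ℝ) / 3)⁻¹ ^ 5) := Real.sqrt_nonneg _
      refine mul_le_mul_of_nonneg_left (add_le_add ?_ le_rfl) hC0
      exact mul_le_mul_of_nonneg_left hen hs5
    -- the full exterior defect at radius `M ρ`, with `g t ≤ |g t|`
    have hloc := (hH M hM t ht x ρ hρ hpeak hball hmaxrad e he).trans
      (add_le_add le_rfl (le_abs_self (g t)))
    -- split the shell gradient through `∇u(t,x)`
    exact (shellEquiv_abs_inner_sub_le_of_common _ _ _ e hfar hloc).trans_eq (add_assoc _ _ _)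

/-- **Rate-form modulus ⇔ rate-form shell locality.** Under the scale-free re-typing of the crux, the far-field /
shell cut again isolates the whole content in the shell statement (`⇐` `bRate_of_shellRate`, `⇒` `shellRate_of_bRate`):
a line for the re-typed crux must bring structure for the SHELL (shape of the collapsing set), not another split.
[folklore] -/
theorem bRate_iff_shellRate :
    (∀ (ν T : ℝ), 0 < ν → 0 < T →
    ∀ (u : ℝ → EuclideanSpace ℝ (Fin 3) → EuclideanSpace ℝ (Fin 3)) (p : ℝ → EuclideanSpace ℝ (Fin 3) → ℝ),
      Literature.Analysis.FluidPDE.IsMaximalSmoothSolution ν 0 u p T →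
      Literature.Analysis.FluidPDE.IsLerayHopfOn T ν 0 (u 0) u →
      Literature.Analysis.FluidPDE.HasRapidSpatialDecay (u 0) →
      ∃ (C t₀ : ℝ) (g : ℝ → ℝ), 0 ≤ C ∧ 0 ≤ t₀ ∧ t₀ < T ∧ MeasureTheory.IntegrableOn g (Set.Ico t₀ T) ∧
        ∀ (M : ℝ), 1 ≤ M → ∀ t ∈ Set.Ico t₀ T, ∀ (x : EuclideanSpace ℝ (Fin 3)) (ρ : ℝ), 0 < ρ →
          (⨆ z, ‖Literature.Analysis.FluidPDE.curl (u t) z‖) ≤ 2 * ‖Literature.Analysis.FluidPDE.curl (u t) x‖ →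
          Metric.ball x ρ ⊆ {y | (⨆ z, ‖Literature.Analysis.FluidPDE.curl (u t) z‖) ≤ 4 * ‖Literature.Analysis.FluidPDE.curl (u t) y‖} →
          (∀ (x' : EuclideanSpace ℝ (Fin 3)) (ρ' : ℝ),
            (⨆ z, ‖Literature.Analysis.FluidPDE.curl (u t) z‖) ≤ 2 * ‖Literature.Analysis.FluidPDE.curl (u t) x'‖ →
            Metric.ball x' ρ' ⊆ {y | (⨆ z, ‖Literature.Analysis.FluidPDE.curl (u t) z‖) ≤ 4 * ‖Literature.Analysis.FluidPDE.curl (u t) y‖} →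
            ρ' ≤ 2 * ρ) →
          ∀ e : EuclideanSpace ℝ (Fin 3), ‖e‖ = 1 →
            |inner ℝ ((fderiv ℝ (u t) x - fderiv ℝ (fun z : EuclideanSpace ℝ (Fin 3) => ∫ y, (4 * Real.pi * ‖z - y‖ ^ 3)⁻¹ • Literature.Analysis.FluidPDE.cross ((Metric.ball x (M * ρ)).indicator (Literature.Analysis.FluidPDE.curl (u t)) y) (z - y)) x) e) e|
              ≤ C / M ^ 2 * (⨆ z, ‖Literature.Analysis.FluidPDE.curl (u t) z‖) + g t) ↔
    (∀ (ν T : ℝ), 0 < ν → 0 < T →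
    ∀ (u : ℝ → EuclideanSpace ℝ (Fin 3) → EuclideanSpace ℝ (Fin 3)) (p : ℝ → EuclideanSpace ℝ (Fin 3) → ℝ),
      Literature.Analysis.FluidPDE.IsMaximalSmoothSolution ν 0 u p T →
      Literature.Analysis.FluidPDE.IsLerayHopfOn T ν 0 (u 0) u →
      Literature.Analysis.FluidPDE.HasRapidSpatialDecay (u 0) →
      ∃ (C t₀ R : ℝ) (g₁ : ℝ → ℝ), 0 ≤ C ∧ 0 ≤ t₀ ∧ t₀ < T ∧ 0 < R ∧
        MeasureTheory.IntegrableOn g₁ (Set.Ico t₀ T) ∧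
        ∀ (M : ℝ), 1 ≤ M → ∀ t ∈ Set.Ico t₀ T, ∀ (x : EuclideanSpace ℝ (Fin 3)) (ρ : ℝ), 0 < ρ → M * ρ ≤ R →
          (⨆ z, ‖Literature.Analysis.FluidPDE.curl (u t) z‖) ≤ 2 * ‖Literature.Analysis.FluidPDE.curl (u t) x‖ →
          Metric.ball x ρ ⊆ {y | (⨆ z, ‖Literature.Analysis.FluidPDE.curl (u t) z‖) ≤ 4 * ‖Literature.Analysis.FluidPDE.curl (u t) y‖} →
          (∀ (x' : EuclideanSpace ℝ (Fin 3)) (ρ' : ℝ),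
            (⨆ z, ‖Literature.Analysis.FluidPDE.curl (u t) z‖) ≤ 2 * ‖Literature.Analysis.FluidPDE.curl (u t) x'‖ →
            Metric.ball x' ρ' ⊆ {y | (⨆ z, ‖Literature.Analysis.FluidPDE.curl (u t) z‖) ≤ 4 * ‖Literature.Analysis.FluidPDE.curl (u t) y‖} →
            ρ' ≤ 2 * ρ) →
          ∀ e : EuclideanSpace ℝ (Fin 3), ‖e‖ = 1 →
            |inner ℝ ((fderiv ℝ (fun z : EuclideanSpace ℝ (Fin 3) => ∫ y, (4 * Real.pi * ‖z - y‖ ^ 3)⁻¹ • Literature.Analysis.FluidPDE.cross ((Metric.ball x R).indicator (Literature.Analysis.FluidPDE.curl (u t)) y) (z - y)) x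
              - fderiv ℝ (fun z : EuclideanSpace ℝ (Fin 3) => ∫ y, (4 * Real.pi * ‖z - y‖ ^ 3)⁻¹ • Literature.Analysis.FluidPDE.cross ((Metric.ball x (M * ρ)).indicator (Literature.Analysis.FluidPDE.curl (u t)) y) (z - y)) x) e) e|
              ≤ C / M ^ 2 * (⨆ z, ‖Literature.Analysis.FluidPDE.curl (u t) z‖) + g₁ t) :=
  ⟨shellRate_of_bRate, bRate_of_shellRate⟩

end Summit.NavierStokesRegularity.NavierStokesRegularity.Theorems.BlowupIsLocallyDriven.Rate

end
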